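import Summits.QuantumFields.BalabanUV.Beta.D1BFx.ColumnGaugeDefectEnvelope
import Summits.QuantumFields.BalabanUV.Beta.D1BFx.DshEntrySharp

/-!
# `BalabanUV.Beta.D1BFx.ColumnGaugeDefectRecord` — road «BF-x», binder row D1, PART 24 HEAD §4 (b): **THE TWO DISPLAYED `Dsh`-WORDS OF THE ROAD's PIN IDENTITY
# (`ChartDefectTwoPinsRoad.hessKer_G0bm_record_eq`, OWNER d1-p2 g24 INTENT-6) ARE VERTEX FAMILIES WITH THE POWER DISPLAYED — `G^{Dsh} μ y = [Λc μ y, Dsh n]` is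
# `BiLoc` at `(n•y, n•y)` with constant `8·C₄·e^{5κ′∕2}·n⁴` and rate `κ₁₆₃(4)∕(32n)`, `W^{Dsh} μ y ν y′ = −[Λc ν y′, [Λc μ y, Dsh n]]` is `BiLoc` at the PAIR `(n•y, n•y′)` with
# constant `16·C₄²·e^{3κ′}·(1 + e^{2κ′})²·n⁴` and rate `κ₁₆₃(4)∕(16n)`** (`C₄ := MG163 4·periodConst (κ₁₆₃ 4) 3`, `κ′ := κ₁₆₃(4)∕4`; `Λc μ y := diagK (z b ↦ (n⁴∕2)·χ_{μ,y} (legSite ρ_c z b))`,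
# `χ_{μ,y} := bmGaugeAt ρ_c (colH K₀ n μ y) n`, `K₀ := KInvStep 3 n 0`, `ρ_c := ctr 4 n` — EXACTLY the letters of the (H3-road) identity's right-hand side), i.e. in the currency
# `ExpKernelCalculus.VertexFamily ∕ VertexFamily₂` that `decay510_hessKer` and an5's trace bounds consume.  LOCATED COUNT (honest): in this sup-entry currency the locked weight
# `(n⁴∕2)·χ` is `O(1)` (`4·C₄·e^{κ′}`, `DressedVertexSplit.abs_bmGaugeAt_weight_le` × `PackedColumnEnvelope.abs_colH_KInvStep_zero_le`) and EVERY power of `n` in both constants is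
# the ENTRY letter of an1's shift, in its SHARP form `DshEntrySharp.abs_Dsh_le_pow`: `|Dsh n| ≤ n⁴` (a rooted axial contour crosses a bond at most once; an1's `DshAn1Spread.abs_Dsh_le`
# reads `cDsh 3 n = 8·n⁵`).  The weight route (`ColumnGaugeDefectEnvelope` §6) is used: g29's crude gradient envelope would cost one more power of `n`.

HONEST DEPENDENCY (cell records, verbatim): «continuum YM on T⁴ ⇐ BetaPertH ∧ nine spine estimates (0/9 proved); BetaPertH ⇐ (D1) ∧ (D4) ∧
CAP+tail; G-an2-4 gates asym, D1 and NE2/3/4.»  HONEST FRAMING (cell contract, verbatim): «discharging `BetaPertH` makes Bałaban's UV stability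
UNCONDITIONAL — a real constructive-QFT result; it is NOT the continuum limit and NOT the Clay problem.»  THIS MODULE composes letters BY NAME (`DshEntrySharp.abs_Dsh_le_pow`, an1's
`Dsh_ne_zero_window`, g29's `abs_bmGaugeAt_weight_le`, gan24-leaf-05 g53's `abs_colH_KInvStep_zero_le`, `ColumnGaugeDefectEnvelope` §6); hypothesis-free but `1 ≤ n`.  No `def`,
no `def … : Prop`, nothing cited, NO printed hypothesis, 0 sorry.  It is a LETTER for the HEAD's border rows (b), not a (1.22) row: the words' traces against the road kernel's legs
and the `n`-count of the row are the HEAD's; 0 root-level binders of row D1 discharged; (K) NOT closed; (J1) ONE OPEN ROW; NOT D1, NEVER «G-an2-4 closed», NOT `BetaPertH`,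
NOT continuum, NOT Clay.

ABSOLUTE RULE (cell charter, verbatim): «No internally-minted statement may enter as a cited fact. Every hypothesis is either kernel-proved in
this package or a verbatim quotation of a PUBLISHED theorem with page reference. The manuscript(s) under audit are NOT citable for their own
disputed steps — they are the thing under adjudication; programme-internal (2001/route/tribunal) claims are never citable.»

CONTENT (`d = 3`, blocking `n ≥ 1`).  §1 `l1_ctr_le` (the centred root has `|ρ_c|₁ ≤ (d+1)·L∕2`), `abs_lockedWeight_record_le` (`|(n⁴∕2)·χ_{μ,y} w| ≤ 4·C₄·e^{κ′}·e^{−(κ′∕(4n))|w − n•y|₁}`).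
§2 `biLoc_GDsh_record`, `biLoc_WDsh_record` (the two words in the OWNER's letters, leading sign of `W^{Dsh}` included).  §3 `vertexFamily_GDsh_record`, `vertexFamily₂_WDsh_record`.
Unit `b2b-balaban-beta-d1-formalise-leaf-01` (gen 32), D1 formalisation swarm LEAF PROVER 01, road «BF-x»; OFFER O-2 of W-5 l.51697 ∕ W-1 l.52359.  Not in print; our bookkeeping.
No existing file touched.
-/

noncomputable section

namespace Summit.QuantumFields.BalabanUV.Beta.D1BFx.ColumnGaugeDefectRecord

open Literature.MathematicalPhysics.QuantumFieldTheory
open Literature.MathematicalPhysics.QuantumFieldTheory.LatticeForm (quo)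
open Literature.MathematicalPhysics.QuantumFieldTheory.Balaban1983to89
open Literature.MathematicalPhysics.QuantumFieldTheory.Balaban1983to89.Beta
open B12Sec2to5 (l1 l1_nonneg)
open B4ContourShift (supNorm)
open ExpKernelCalculus (MKer BiLoc VertexFamily VertexFamily₂ comp)
open OneStepResolventKernel (Fib)
open OneStepKernelFamily (colH KInvStep)
open AffineAveraging (Site box toSite)
open AveragingContoursRooted (ctr ctrOff ctrOff_mem_box)
open Summit.QuantumFields.BalabanUV.Beta.BorderedHessian (diagK)
open Summit.QuantumFields.BalabanUV.Beta.DshAn1 (Dsh Dsh_ne_zero_window)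
open Summit.QuantumFields.BalabanUV.Beta.D1BFx.DshEntrySharp (abs_Dsh_le_pow)
open Summit.QuantumFields.BalabanUV.Beta.AxialProjectorBlockMean (bmGaugeAt)
open Summit.QuantumFields.BalabanUV.Beta.AveragingWardRootedStencils (legSite)
open Summit.QuantumFields.BalabanUV.Beta.D1BFx.PackedColumnEnvelope (abs_colH_KInvStep_zero_le)
open Summit.QuantumFields.BalabanUV.Beta.D1BFx.DressedVertexSplit (abs_bmGaugeAt_weight_le)
open Summit.QuantumFields.BalabanUV.Beta.D1BFx.ColumnGaugeDefectEnvelope (biLoc_commDefect_of_weight biLoc_commCommDefect_of_weight)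
open OneStepResolventKernel (biLoc_mono)
open SecondOrderResponse (biLoc_neg)
open B5Hk163Strip (kappa163 kappa163_pos)
open B5Hk163Decay (MG163)
open B4TorusKernel (periodConst)

variable {n : ℕ} [NeZero n]

/-! ## §1 The centred root and the locked weight of the record's column generator -/

/-- [folklore] The centred root `ctr (d+1) L = toSite (fun _ ↦ (L − 1)∕2)` has `|ctr (d+1) L|₁ ≤ (d+1)·L∕2`. -/
theorem l1_ctr_le (d L : ℕ) : l1 (ctr (d + 1) L) ≤ ((d : ℝ) + 1) * L / 2 := by
  have h1 : ∀ i : Fin (d + 1), |((ctr (d + 1) L i : ℤ) : ℝ)| ≤ (L : ℝ) / 2 := fun i => by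
    have e : ctr (d + 1) L i = (((L - 1) / 2 : ℕ) : ℤ) := rfl
    rw [e, Int.cast_natCast, abs_of_nonneg (Nat.cast_nonneg _)]
    have h2 : 2 * ((L - 1) / 2) ≤ L := (Nat.mul_div_le (L - 1) 2 |>.trans (Nat.sub_le L 1) : 2 * ((L - 1) / 2) ≤ L)
    have h3 : (2 : ℝ) * (((L - 1) / 2 : ℕ) : ℝ) ≤ L := by exact_mod_cast h2
    linarith
  calc l1 (ctr (d + 1) L) = ∑ i : Fin (d + 1), |((ctr (d + 1) L i : ℤ) : ℝ)| := rfl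
    _ ≤ ∑ _i : Fin (d + 1), (L : ℝ) / 2 := Finset.sum_le_sum fun i _ => h1 i
    _ = ((d : ℝ) + 1) * L / 2 := by rw [Finset.sum_const, Finset.card_univ, Fintype.card_fin, nsmul_eq_mul]; push_cast; ring

/-- [folklore] **THE LOCKED WEIGHT OF THE RECORD's COLUMN GENERATOR IS `O(1)` AND `ℓ¹`-DECAYING FROM THE BOND's BLOCK**: with `K₀ := KInvStep 3 n 0`, `ρ_c := ctr 4 n`,
`C₄ := MG163 4·periodConst (κ₁₆₃ 4) 3`, `κ′ := κ₁₆₃(4)∕4`: `|(n⁴∕2)·bmGaugeAt ρ_c (colH K₀ n μ y) n w| ≤ 4·C₄·e^{κ′}·e^{−(κ′∕(4n))·|w − n•y|₁}` (g29's weight envelope × g53's column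
envelope; the factor `n⁴·n·n⁻⁵ = 1`). -/
theorem abs_lockedWeight_record_le (hn : 1 ≤ n) (μ : Fin (3 + 1)) (y w : Site (3 + 1)) :
    |(n : ℝ) ^ 4 / 2 * bmGaugeAt (ctr 4 n) (colH (KInvStep (d := 3) n 0) n μ y) n w|
      ≤ 4 * (MG163 (3 + 1) * periodConst (kappa163 (3 + 1)) 3) * Real.exp (kappa163 (3 + 1) / ((3 : ℝ) + 1))
          * Real.exp (-(kappa163 (3 + 1) / ((3 : ℝ) + 1) / (((3 : ℝ) + 1) * n)) * l1 (w - (n : ℤ) • y)) := by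
  have hn0 : (0 : ℝ) < n := by exact_mod_cast hn
  have hcol : ∀ (κ : Fin (3 + 1)) (u : Site (3 + 1)), |colH (KInvStep (d := 3) n 0) n μ y κ u|
      ≤ ((n : ℝ) ^ (3 + 2))⁻¹ * (MG163 (3 + 1) * periodConst (kappa163 (3 + 1)) 3)
          * Real.exp (-(kappa163 (3 + 1) / ((3 : ℝ) + 1) * supNorm (quo n u - y))) :=
    fun κ u => abs_colH_KInvStep_zero_le (d := 3) (N := n) hn μ y κ u
  have hM : 0 ≤ ((n : ℝ) ^ (3 + 2))⁻¹ * (MG163 (3 + 1) * periodConst (kappa163 (3 + 1)) 3) :=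
    (mul_nonneg_iff_of_pos_right (Real.exp_pos _)).1 ((abs_nonneg _).trans (hcol 0 0))
  have hc : 0 ≤ kappa163 (3 + 1) / ((3 : ℝ) + 1) := (div_pos (kappa163_pos (3 + 1)) (by positivity)).le
  have hχ : |bmGaugeAt (ctr 4 n) (colH (KInvStep (d := 3) n 0) n μ y) n w|
      ≤ (2 * (((3 : ℝ) + 1) * n) * (((n : ℝ) ^ (3 + 2))⁻¹ * (MG163 (3 + 1) * periodConst (kappa163 (3 + 1)) 3))) * Real.exp (kappa163 (3 + 1) / ((3 : ℝ) + 1))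
          * Real.exp (-(kappa163 (3 + 1) / ((3 : ℝ) + 1) / (((3 : ℝ) + 1) * n)) * l1 (w - (n : ℤ) • y)) :=
    abs_bmGaugeAt_weight_le hn (ctrOff_mem_box hn) (KInvStep (d := 3) n 0) μ y hM hc hcol w
  rw [abs_mul, abs_of_nonneg (by positivity : (0 : ℝ) ≤ (n : ℝ) ^ 4 / 2)]
  refine (mul_le_mul_of_nonneg_left hχ (by positivity)).trans (le_of_eq ?_)
  have h5 : (n : ℝ) ^ 4 / 2 * (2 * (((3 : ℝ) + 1) * n) * (((n : ℝ) ^ (3 + 2))⁻¹ * (MG163 (3 + 1) * periodConst (kappa163 (3 + 1)) 3)))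
      = 4 * (MG163 (3 + 1) * periodConst (kappa163 (3 + 1)) 3) := by
    field_simp
    ring
  rw [← h5]
  ring

/-! ## §2 The two displayed `Dsh`-words of `ChartDefectTwoPinsRoad.hessKer_G0bm_record_eq`, bi-localised with the power displayed -/

/-- **`G^{Dsh}` OF THE RECORD IS A FIRST-ORDER VERTEX-FAMILY MEMBER, POWER `n⁵` DISPLAYED** [our objects]: for `1 ≤ n` and every coarse bond `(μ, y)`,
`BiLoc ([Λc μ y, Dsh n]) (n•y) (n•y) (8·C₄·e^{5κ′∕2}·n⁴) (κ₁₆₃(4)∕(32n))`, `Λc μ y := diagK (z b ↦ (n⁴∕2)·bmGaugeAt ρ_c (colH K₀ n μ y) n (legSite ρ_c z b))` — the letters of the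
(H3-road) identity.  Inputs: `ColumnGaugeDefectEnvelope.biLoc_commDefect_of_weight` with `|Dsh n| ≤ n⁴` (`DshEntrySharp.abs_Dsh_le_pow`) and an1's window `cube 4 (2n)`, §1's weight, `|ρ_c|₁ ≤ 2n`. -/
theorem biLoc_GDsh_record (hn : 1 ≤ n) (μ : Fin (3 + 1)) (y : Site (3 + 1)) :
    BiLoc (comp (diagK fun z' b => (n : ℝ) ^ 4 / 2 * bmGaugeAt (ctr 4 n) (colH (KInvStep (d := 3) n 0) n μ y) n (legSite (ctr 4 n) z' b)) (Dsh n)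
        - comp (Dsh n) (diagK fun z' b => (n : ℝ) ^ 4 / 2 * bmGaugeAt (ctr 4 n) (colH (KInvStep (d := 3) n 0) n μ y) n (legSite (ctr 4 n) z' b)))
      ((n : ℤ) • y) ((n : ℤ) • y)
      (8 * (MG163 (3 + 1) * periodConst (kappa163 (3 + 1)) 3) * Real.exp (5 / 2 * (kappa163 (3 + 1) / ((3 : ℝ) + 1))) * (n : ℝ) ^ 4)
      (kappa163 (3 + 1) / (32 * n)) := by
  have hn0 : (0 : ℝ) < n := by exact_mod_cast hn
  -- the column envelope of `K₀` (g53) and the weight envelope of `χ_{μ,y}` (g29)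
  have hcol : ∀ (κ : Fin (3 + 1)) (u : Site (3 + 1)), |colH (KInvStep (d := 3) n 0) n μ y κ u|
      ≤ ((n : ℝ) ^ (3 + 2))⁻¹ * (MG163 (3 + 1) * periodConst (kappa163 (3 + 1)) 3)
          * Real.exp (-(kappa163 (3 + 1) / ((3 : ℝ) + 1) * supNorm (quo n u - y))) :=
    fun κ u => abs_colH_KInvStep_zero_le (d := 3) (N := n) hn μ y κ u
  have hM : 0 ≤ ((n : ℝ) ^ (3 + 2))⁻¹ * (MG163 (3 + 1) * periodConst (kappa163 (3 + 1)) 3) :=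
    (mul_nonneg_iff_of_pos_right (Real.exp_pos _)).1 ((abs_nonneg _).trans (hcol 0 0))
  have hC₄ : 0 ≤ MG163 (3 + 1) * periodConst (kappa163 (3 + 1)) 3 :=
    (mul_nonneg_iff_of_pos_left (by positivity)).1 hM
  have hc : 0 ≤ kappa163 (3 + 1) / ((3 : ℝ) + 1) := (div_pos (kappa163_pos (3 + 1)) (by positivity)).le
  have hδ : 0 ≤ kappa163 (3 + 1) / ((3 : ℝ) + 1) / (((3 : ℝ) + 1) * n) := by positivity
  have hχ : ∀ w, |bmGaugeAt (ctr 4 n) (colH (KInvStep (d := 3) n 0) n μ y) n w|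
      ≤ (2 * (((3 : ℝ) + 1) * n) * (((n : ℝ) ^ (3 + 2))⁻¹ * (MG163 (3 + 1) * periodConst (kappa163 (3 + 1)) 3))) * Real.exp (kappa163 (3 + 1) / ((3 : ℝ) + 1))
          * Real.exp (-(kappa163 (3 + 1) / ((3 : ℝ) + 1) / (((3 : ℝ) + 1) * n)) * l1 (w - (n : ℤ) • y)) :=
    fun w => abs_bmGaugeAt_weight_le hn (ctrOff_mem_box hn) (KInvStep (d := 3) n 0) μ y hM hc hcol w
  -- the generic weight-route letter at `D := Dsh n`
  have h := biLoc_commDefect_of_weight (fun x z a b => abs_Dsh_le_pow hn x z a b) (fun x z a b hz => Dsh_ne_zero_window hn hz) (by positivity) hδ hχ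
    (ctr 4 n) ((n : ℝ) ^ 4 / 2)
  have hrate : kappa163 (3 + 1) / (32 * n) ≤ kappa163 (3 + 1) / ((3 : ℝ) + 1) / (((3 : ℝ) + 1) * n) / 2 := le_of_eq (by field_simp; ring)
  intro x z a b
  refine ((biLoc_mono h (h.nonneg (Sum.inl 0)) hrate) x z a b).trans (mul_le_mul_of_nonneg_right ?_ (Real.exp_pos _).le)
  · -- the constant: `2·(n⁴∕2)·(8n·n⁻⁵C₄·e^{κ′}·e^{δ|ρ_c|₁})·n⁴·e^{(δ∕2)·4·2n} ≤ 8·C₄·e^{5κ′∕2}·n⁴`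
    have hρ : kappa163 (3 + 1) / ((3 : ℝ) + 1) / (((3 : ℝ) + 1) * n) * l1 (ctr 4 n) ≤ kappa163 (3 + 1) / ((3 : ℝ) + 1) / 2 := by
      have h4 := l1_ctr_le 3 n
      calc kappa163 (3 + 1) / ((3 : ℝ) + 1) / (((3 : ℝ) + 1) * n) * l1 (ctr 4 n)
          ≤ kappa163 (3 + 1) / ((3 : ℝ) + 1) / (((3 : ℝ) + 1) * n) * ((((3 : ℕ) : ℝ) + 1) * n / 2) := mul_le_mul_of_nonneg_left h4 hδ
        _ = kappa163 (3 + 1) / ((3 : ℝ) + 1) / 2 := by push_cast; field_simp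
    have e1 : Real.exp (kappa163 (3 + 1) / ((3 : ℝ) + 1) / (((3 : ℝ) + 1) * n) * l1 (ctr 4 n)) ≤ Real.exp (kappa163 (3 + 1) / ((3 : ℝ) + 1) / 2) :=
      Real.exp_le_exp.2 hρ
    have e2 : Real.exp (kappa163 (3 + 1) / ((3 : ℝ) + 1) / (((3 : ℝ) + 1) * n) / 2 * ((((3 : ℕ) : ℝ) + 1) * ((2 * n : ℕ) : ℝ)))
        = Real.exp (kappa163 (3 + 1) / ((3 : ℝ) + 1)) := by
      congr 1; push_cast; field_simp
    have f1 : 2 * ((n : ℝ) ^ 4 / 2 * (2 * (((3 : ℝ) + 1) * n) * (((n : ℝ) ^ (3 + 2))⁻¹ * (MG163 (3 + 1) * periodConst (kappa163 (3 + 1)) 3))) * (n : ℝ) ^ (3 + 1))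
        = 8 * (MG163 (3 + 1) * periodConst (kappa163 (3 + 1)) 3) * (n : ℝ) ^ 4 := by
      field_simp; ring
    rw [abs_of_nonneg (by positivity : (0 : ℝ) ≤ (n : ℝ) ^ 4 / 2), e2]
    calc 2 * ((n : ℝ) ^ 4 / 2 * ((2 * (((3 : ℝ) + 1) * n) * (((n : ℝ) ^ (3 + 2))⁻¹ * (MG163 (3 + 1) * periodConst (kappa163 (3 + 1)) 3)))
              * Real.exp (kappa163 (3 + 1) / ((3 : ℝ) + 1))
              * Real.exp (kappa163 (3 + 1) / ((3 : ℝ) + 1) / (((3 : ℝ) + 1) * n) * l1 (ctr 4 n))) * (n : ℝ) ^ (3 + 1))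
          * Real.exp (kappa163 (3 + 1) / ((3 : ℝ) + 1))
        = 2 * ((n : ℝ) ^ 4 / 2 * (2 * (((3 : ℝ) + 1) * n) * (((n : ℝ) ^ (3 + 2))⁻¹ * (MG163 (3 + 1) * periodConst (kappa163 (3 + 1)) 3))) * (n : ℝ) ^ (3 + 1))
          * (Real.exp (kappa163 (3 + 1) / ((3 : ℝ) + 1)) * Real.exp (kappa163 (3 + 1) / ((3 : ℝ) + 1) / (((3 : ℝ) + 1) * n) * l1 (ctr 4 n))
              * Real.exp (kappa163 (3 + 1) / ((3 : ℝ) + 1))) := by ring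
      _ ≤ (8 * (MG163 (3 + 1) * periodConst (kappa163 (3 + 1)) 3) * (n : ℝ) ^ 4)
          * (Real.exp (kappa163 (3 + 1) / ((3 : ℝ) + 1)) * Real.exp (kappa163 (3 + 1) / ((3 : ℝ) + 1) / 2)
              * Real.exp (kappa163 (3 + 1) / ((3 : ℝ) + 1))) := by
        rw [f1]
        have hA : 0 ≤ 8 * (MG163 (3 + 1) * periodConst (kappa163 (3 + 1)) 3) * (n : ℝ) ^ 4 := by positivity
        exact mul_le_mul_of_nonneg_left (mul_le_mul_of_nonneg_right (mul_le_mul_of_nonneg_left e1 (by positivity)) (by positivity)) hA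
      _ = _ := by rw [← Real.exp_add, ← Real.exp_add]; ring_nf

/-- **`W^{Dsh}` OF THE RECORD IS A SECOND-ORDER VERTEX-FAMILY MEMBER (A CONTACT IN THE BOND PAIR), POWER `n⁵` DISPLAYED** [our objects]: for `1 ≤ n` and every pair of coarse bonds,
`BiLoc (−[Λc ν y′, [Λc μ y, Dsh n]]) (n•y) (n•y′) (16·C₄²·e^{3κ′}·(1 + e^{2κ′})²·n⁴) (κ₁₆₃(4)∕(16n))` — the letters AND the leading sign of the (H3-road) identity's `W`-slot.
Inputs: `ColumnGaugeDefectEnvelope.biLoc_commCommDefect_of_weight` (outer weight `χ_{ν,y′}` from `n•y′`, inner `χ_{μ,y}` from `n•y`), `abs_Dsh_le_pow`, an1's window, §1, `biLoc_neg`. -/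
theorem biLoc_WDsh_record (hn : 1 ≤ n) (μ : Fin (3 + 1)) (y : Site (3 + 1)) (ν : Fin (3 + 1)) (y' : Site (3 + 1)) :
    BiLoc (-(comp (diagK fun z' b => (n : ℝ) ^ 4 / 2 * bmGaugeAt (ctr 4 n) (colH (KInvStep (d := 3) n 0) n ν y') n (legSite (ctr 4 n) z' b))
                (comp (diagK fun z' b => (n : ℝ) ^ 4 / 2 * bmGaugeAt (ctr 4 n) (colH (KInvStep (d := 3) n 0) n μ y) n (legSite (ctr 4 n) z' b)) (Dsh n)
                  - comp (Dsh n) (diagK fun z' b => (n : ℝ) ^ 4 / 2 * bmGaugeAt (ctr 4 n) (colH (KInvStep (d := 3) n 0) n μ y) n (legSite (ctr 4 n) z' b)))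
              - comp (comp (diagK fun z' b => (n : ℝ) ^ 4 / 2 * bmGaugeAt (ctr 4 n) (colH (KInvStep (d := 3) n 0) n μ y) n (legSite (ctr 4 n) z' b)) (Dsh n)
                  - comp (Dsh n) (diagK fun z' b => (n : ℝ) ^ 4 / 2 * bmGaugeAt (ctr 4 n) (colH (KInvStep (d := 3) n 0) n μ y) n (legSite (ctr 4 n) z' b)))
                (diagK fun z' b => (n : ℝ) ^ 4 / 2 * bmGaugeAt (ctr 4 n) (colH (KInvStep (d := 3) n 0) n ν y') n (legSite (ctr 4 n) z' b))))
      ((n : ℤ) • y) ((n : ℤ) • y')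
      (16 * (MG163 (3 + 1) * periodConst (kappa163 (3 + 1)) 3) ^ 2 * Real.exp (3 * (kappa163 (3 + 1) / ((3 : ℝ) + 1)))
          * (1 + Real.exp (2 * (kappa163 (3 + 1) / ((3 : ℝ) + 1)))) ^ 2 * (n : ℝ) ^ 4)
      (kappa163 (3 + 1) / (16 * n)) := by
  have hn0 : (0 : ℝ) < n := by exact_mod_cast hn
  have hcol : ∀ (μ' : Fin (3 + 1)) (y'' : Site (3 + 1)) (κ : Fin (3 + 1)) (u : Site (3 + 1)), |colH (KInvStep (d := 3) n 0) n μ' y'' κ u|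
      ≤ ((n : ℝ) ^ (3 + 2))⁻¹ * (MG163 (3 + 1) * periodConst (kappa163 (3 + 1)) 3)
          * Real.exp (-(kappa163 (3 + 1) / ((3 : ℝ) + 1) * supNorm (quo n u - y''))) :=
    fun μ' y'' κ u => abs_colH_KInvStep_zero_le (d := 3) (N := n) hn μ' y'' κ u
  have hM : 0 ≤ ((n : ℝ) ^ (3 + 2))⁻¹ * (MG163 (3 + 1) * periodConst (kappa163 (3 + 1)) 3) :=
    (mul_nonneg_iff_of_pos_right (Real.exp_pos _)).1 ((abs_nonneg _).trans (hcol 0 0 0 0))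
  have hC₄ : 0 ≤ MG163 (3 + 1) * periodConst (kappa163 (3 + 1)) 3 :=
    (mul_nonneg_iff_of_pos_left (by positivity)).1 hM
  have hc : 0 ≤ kappa163 (3 + 1) / ((3 : ℝ) + 1) := (div_pos (kappa163_pos (3 + 1)) (by positivity)).le
  have hδ : 0 ≤ kappa163 (3 + 1) / ((3 : ℝ) + 1) / (((3 : ℝ) + 1) * n) := by positivity
  have hχ : ∀ (μ' : Fin (3 + 1)) (y'' : Site (3 + 1)) (w : Site (3 + 1)), |bmGaugeAt (ctr 4 n) (colH (KInvStep (d := 3) n 0) n μ' y'') n w|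
      ≤ (2 * (((3 : ℝ) + 1) * n) * (((n : ℝ) ^ (3 + 2))⁻¹ * (MG163 (3 + 1) * periodConst (kappa163 (3 + 1)) 3))) * Real.exp (kappa163 (3 + 1) / ((3 : ℝ) + 1))
          * Real.exp (-(kappa163 (3 + 1) / ((3 : ℝ) + 1) / (((3 : ℝ) + 1) * n)) * l1 (w - (n : ℤ) • y'')) :=
    fun μ' y'' w => abs_bmGaugeAt_weight_le hn (ctrOff_mem_box hn) (KInvStep (d := 3) n 0) μ' y'' hM hc (hcol μ' y'') w
  have h := biLoc_commCommDefect_of_weight (fun x z a b => abs_Dsh_le_pow hn x z a b) (fun x z a b hz => Dsh_ne_zero_window hn hz) (by positivity) (by positivity) hδ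
    (hχ μ y) (hχ ν y') (ctr 4 n) ((n : ℝ) ^ 4 / 2) ((n : ℝ) ^ 4 / 2)
  have hrate : kappa163 (3 + 1) / (16 * n) ≤ kappa163 (3 + 1) / ((3 : ℝ) + 1) / (((3 : ℝ) + 1) * n) := le_of_eq (by field_simp; ring)
  intro x z a b
  refine ((biLoc_mono (biLoc_neg h) (h.nonneg (Sum.inl 0)) hrate) x z a b).trans (mul_le_mul_of_nonneg_right ?_ (Real.exp_pos _).le)
  · have hρ : kappa163 (3 + 1) / ((3 : ℝ) + 1) / (((3 : ℝ) + 1) * n) * l1 (ctr 4 n) ≤ kappa163 (3 + 1) / ((3 : ℝ) + 1) / 2 := by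
      have h4 := l1_ctr_le 3 n
      calc kappa163 (3 + 1) / ((3 : ℝ) + 1) / (((3 : ℝ) + 1) * n) * l1 (ctr 4 n)
          ≤ kappa163 (3 + 1) / ((3 : ℝ) + 1) / (((3 : ℝ) + 1) * n) * ((((3 : ℕ) : ℝ) + 1) * n / 2) := mul_le_mul_of_nonneg_left h4 hδ
        _ = kappa163 (3 + 1) / ((3 : ℝ) + 1) / 2 := by push_cast; field_simp
    have e1 : Real.exp (kappa163 (3 + 1) / ((3 : ℝ) + 1) / (((3 : ℝ) + 1) * n) * l1 (ctr 4 n)) ≤ Real.exp (kappa163 (3 + 1) / ((3 : ℝ) + 1) / 2) :=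
      Real.exp_le_exp.2 hρ
    have e2 : Real.exp (kappa163 (3 + 1) / ((3 : ℝ) + 1) / (((3 : ℝ) + 1) * n) * ((((3 : ℕ) : ℝ) + 1) * ((2 * n : ℕ) : ℝ)))
        = Real.exp (2 * (kappa163 (3 + 1) / ((3 : ℝ) + 1))) := by
      congr 1; push_cast; field_simp
    have f0 : (n : ℝ) ^ 4 / 2 * (2 * (((3 : ℝ) + 1) * n) * (((n : ℝ) ^ (3 + 2))⁻¹ * (MG163 (3 + 1) * periodConst (kappa163 (3 + 1)) 3)))
        = 4 * (MG163 (3 + 1) * periodConst (kappa163 (3 + 1)) 3) := by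
      field_simp; ring
    have f2 : ((n : ℕ) : ℝ) ^ (3 + 1) = (n : ℝ) ^ 4 := by norm_num
    rw [abs_of_nonneg (by positivity : (0 : ℝ) ≤ (n : ℝ) ^ 4 / 2), e2, f2]
    -- abbreviate the `n`-free letters
    set C₄ : ℝ := MG163 (3 + 1) * periodConst (kappa163 (3 + 1)) 3 with hC₄def
    set κ' : ℝ := kappa163 (3 + 1) / ((3 : ℝ) + 1) with hκ'def
    set Eρ : ℝ := Real.exp (κ' / (((3 : ℝ) + 1) * n) * l1 (ctr 4 n)) with hEρ
    have hEρ' : Eρ ≤ Real.exp (κ' / 2) := e1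
    have hA : (n : ℝ) ^ 4 / 2 * (2 * (((3 : ℝ) + 1) * n) * (((n : ℝ) ^ (3 + 2))⁻¹ * C₄) * Real.exp κ' * Eρ) = 4 * C₄ * Real.exp κ' * Eρ := by
      rw [← f0]; ring
    rw [hA]
    have hB : 4 * C₄ * Real.exp κ' * Eρ ≤ 4 * C₄ * Real.exp κ' * Real.exp (κ' / 2) := mul_le_mul_of_nonneg_left hEρ' (by positivity)
    have hBn : 0 ≤ 4 * C₄ * Real.exp κ' * Eρ := by positivity
    calc 4 * C₄ * Real.exp κ' * Eρ * (4 * C₄ * Real.exp κ' * Eρ * (n : ℝ) ^ 4) * (1 + Real.exp (2 * κ')) ^ 2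
        ≤ (4 * C₄ * Real.exp κ' * Real.exp (κ' / 2)) * ((4 * C₄ * Real.exp κ' * Real.exp (κ' / 2)) * (n : ℝ) ^ 4) * (1 + Real.exp (2 * κ')) ^ 2 := by
          gcongr
      _ = 16 * C₄ ^ 2 * (Real.exp κ' * Real.exp κ' * (Real.exp (κ' / 2) * Real.exp (κ' / 2))) * (1 + Real.exp (2 * κ')) ^ 2 * (n : ℝ) ^ 4 := by ring
      _ = _ := by rw [← Real.exp_add, ← Real.exp_add, ← Real.exp_add]; ring_nf

/-! ## §3 In the currency of `ExpKernelCalculus.decay510_hessKer` -/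

/-- **`G^{Dsh}` IS A `VertexFamily` AT BLOCKING `n`** [our objects] (restatement of `biLoc_GDsh_record`). -/
theorem vertexFamily_GDsh_record (hn : 1 ≤ n) :
    VertexFamily (fun μ y => comp (diagK fun z' b => (n : ℝ) ^ 4 / 2 * bmGaugeAt (ctr 4 n) (colH (KInvStep (d := 3) n 0) n μ y) n (legSite (ctr 4 n) z' b)) (Dsh n)
        - comp (Dsh n) (diagK fun z' b => (n : ℝ) ^ 4 / 2 * bmGaugeAt (ctr 4 n) (colH (KInvStep (d := 3) n 0) n μ y) n (legSite (ctr 4 n) z' b))) n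
      (8 * (MG163 (3 + 1) * periodConst (kappa163 (3 + 1)) 3) * Real.exp (5 / 2 * (kappa163 (3 + 1) / ((3 : ℝ) + 1))) * (n : ℝ) ^ 4)
      (kappa163 (3 + 1) / (32 * n)) :=
  fun μ y => biLoc_GDsh_record hn μ y

/-- **`W^{Dsh}` IS A `VertexFamily₂` AT BLOCKING `n`** [our objects] (restatement of `biLoc_WDsh_record`). -/
theorem vertexFamily₂_WDsh_record (hn : 1 ≤ n) :
    VertexFamily₂ (fun μ y ν y' =>
        -(comp (diagK fun z' b => (n : ℝ) ^ 4 / 2 * bmGaugeAt (ctr 4 n) (colH (KInvStep (d := 3) n 0) n ν y') n (legSite (ctr 4 n) z' b))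
              (comp (diagK fun z' b => (n : ℝ) ^ 4 / 2 * bmGaugeAt (ctr 4 n) (colH (KInvStep (d := 3) n 0) n μ y) n (legSite (ctr 4 n) z' b)) (Dsh n)
                - comp (Dsh n) (diagK fun z' b => (n : ℝ) ^ 4 / 2 * bmGaugeAt (ctr 4 n) (colH (KInvStep (d := 3) n 0) n μ y) n (legSite (ctr 4 n) z' b)))
            - comp (comp (diagK fun z' b => (n : ℝ) ^ 4 / 2 * bmGaugeAt (ctr 4 n) (colH (KInvStep (d := 3) n 0) n μ y) n (legSite (ctr 4 n) z' b)) (Dsh n)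
                - comp (Dsh n) (diagK fun z' b => (n : ℝ) ^ 4 / 2 * bmGaugeAt (ctr 4 n) (colH (KInvStep (d := 3) n 0) n μ y) n (legSite (ctr 4 n) z' b)))
              (diagK fun z' b => (n : ℝ) ^ 4 / 2 * bmGaugeAt (ctr 4 n) (colH (KInvStep (d := 3) n 0) n ν y') n (legSite (ctr 4 n) z' b)))) n
      (16 * (MG163 (3 + 1) * periodConst (kappa163 (3 + 1)) 3) ^ 2 * Real.exp (3 * (kappa163 (3 + 1) / ((3 : ℝ) + 1)))
          * (1 + Real.exp (2 * (kappa163 (3 + 1) / ((3 : ℝ) + 1)))) ^ 2 * (n : ℝ) ^ 4)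
      (kappa163 (3 + 1) / (16 * n)) :=
  fun μ y ν y' => biLoc_WDsh_record hn μ y ν y'

/-! ## §4 (v1.2, append-only) The double commutator WITHOUT the leading sign — the spelling of the (H3-Δ) word list

The OWNER d1-p2 g25's `ChartDefectTwoPins.chartDefect_record_eq_words` (INTENT-1 l.53447, staged dc07d5e216e07cd4) displays the `Dsh`-tadpole row as
`½·tadpole G₀ ([Λc ν₀ z₀, [Λc μ₀ 0, Dsh n]])` (= `−½·tadpole G₀ (W^{Dsh} μ₀ 0 ν₀ z₀)`), i.e. the bracket of §2 without its sign; this section records that bracket's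
`BiLoc` ∕ `VertexFamily₂` letter under its own name so the row reads it with no `neg_neg` adapter (same constant, same rate). -/

/-- **`[Λc ν y′, [Λc μ y, Dsh n]]` OF THE RECORD (no leading sign) IS A CONTACT IN THE BOND PAIR, POWER `n⁴` DISPLAYED** [our objects]:
`BiLoc ([Λc ν y′, [Λc μ y, Dsh n]]) (n•y) (n•y′) (16·C₄²·e^{3κ′}·(1 + e^{2κ′})²·n⁴) (κ₁₆₃(4)∕(16n))` — `biLoc_WDsh_record` is its negation. -/
theorem biLoc_commComm_record (hn : 1 ≤ n) (μ : Fin (3 + 1)) (y : Site (3 + 1)) (ν : Fin (3 + 1)) (y' : Site (3 + 1)) :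
    BiLoc (comp (diagK fun z' b => (n : ℝ) ^ 4 / 2 * bmGaugeAt (ctr 4 n) (colH (KInvStep (d := 3) n 0) n ν y') n (legSite (ctr 4 n) z' b))
                (comp (diagK fun z' b => (n : ℝ) ^ 4 / 2 * bmGaugeAt (ctr 4 n) (colH (KInvStep (d := 3) n 0) n μ y) n (legSite (ctr 4 n) z' b)) (Dsh n)
                  - comp (Dsh n) (diagK fun z' b => (n : ℝ) ^ 4 / 2 * bmGaugeAt (ctr 4 n) (colH (KInvStep (d := 3) n 0) n μ y) n (legSite (ctr 4 n) z' b)))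
              - comp (comp (diagK fun z' b => (n : ℝ) ^ 4 / 2 * bmGaugeAt (ctr 4 n) (colH (KInvStep (d := 3) n 0) n μ y) n (legSite (ctr 4 n) z' b)) (Dsh n)
                  - comp (Dsh n) (diagK fun z' b => (n : ℝ) ^ 4 / 2 * bmGaugeAt (ctr 4 n) (colH (KInvStep (d := 3) n 0) n μ y) n (legSite (ctr 4 n) z' b)))
                (diagK fun z' b => (n : ℝ) ^ 4 / 2 * bmGaugeAt (ctr 4 n) (colH (KInvStep (d := 3) n 0) n ν y') n (legSite (ctr 4 n) z' b)))
      ((n : ℤ) • y) ((n : ℤ) • y')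
      (16 * (MG163 (3 + 1) * periodConst (kappa163 (3 + 1)) 3) ^ 2 * Real.exp (3 * (kappa163 (3 + 1) / ((3 : ℝ) + 1)))
          * (1 + Real.exp (2 * (kappa163 (3 + 1) / ((3 : ℝ) + 1)))) ^ 2 * (n : ℝ) ^ 4)
      (kappa163 (3 + 1) / (16 * n)) := by
  intro x z a b
  have h := biLoc_WDsh_record (n := n) hn μ y ν y' x z a b
  rw [Pi.neg_apply, Pi.neg_apply, Pi.neg_apply, Pi.neg_apply, abs_neg] at h
  exact h

/-- **THE SAME IN THE `VertexFamily₂` CURRENCY** [our objects] (restatement of `biLoc_commComm_record`). -/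
theorem vertexFamily₂_commComm_record (hn : 1 ≤ n) :
    VertexFamily₂ (fun μ y ν y' =>
        comp (diagK fun z' b => (n : ℝ) ^ 4 / 2 * bmGaugeAt (ctr 4 n) (colH (KInvStep (d := 3) n 0) n ν y') n (legSite (ctr 4 n) z' b))
            (comp (diagK fun z' b => (n : ℝ) ^ 4 / 2 * bmGaugeAt (ctr 4 n) (colH (KInvStep (d := 3) n 0) n μ y) n (legSite (ctr 4 n) z' b)) (Dsh n)
              - comp (Dsh n) (diagK fun z' b => (n : ℝ) ^ 4 / 2 * bmGaugeAt (ctr 4 n) (colH (KInvStep (d := 3) n 0) n μ y) n (legSite (ctr 4 n) z' b)))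
          - comp (comp (diagK fun z' b => (n : ℝ) ^ 4 / 2 * bmGaugeAt (ctr 4 n) (colH (KInvStep (d := 3) n 0) n μ y) n (legSite (ctr 4 n) z' b)) (Dsh n)
              - comp (Dsh n) (diagK fun z' b => (n : ℝ) ^ 4 / 2 * bmGaugeAt (ctr 4 n) (colH (KInvStep (d := 3) n 0) n μ y) n (legSite (ctr 4 n) z' b)))
            (diagK fun z' b => (n : ℝ) ^ 4 / 2 * bmGaugeAt (ctr 4 n) (colH (KInvStep (d := 3) n 0) n ν y') n (legSite (ctr 4 n) z' b))) n
      (16 * (MG163 (3 + 1) * periodConst (kappa163 (3 + 1)) 3) ^ 2 * Real.exp (3 * (kappa163 (3 + 1) / ((3 : ℝ) + 1)))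
          * (1 + Real.exp (2 * (kappa163 (3 + 1) / ((3 : ℝ) + 1)))) ^ 2 * (n : ℝ) ^ 4)
      (kappa163 (3 + 1) / (16 * n)) :=
  fun μ y ν y' => biLoc_commComm_record hn μ y ν y'

end Summit.QuantumFields.BalabanUV.Beta.D1BFx.ColumnGaugeDefectRecord

end
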